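import Mathlib
import HarnessLib
import Summits.AtomisticToContinuum.HydrodynamicLimit.Theorems.RelayRaceLocalityConeLocalisationLocalDefs
import Summits.AtomisticToContinuum.HydrodynamicLimit.Theorems.RelayRaceLocalityNearConstantShortTimeHLStaticLLN
import Summits.AtomisticToContinuum.HydrodynamicLimit.Theorems.RelayRaceLocalityNearConstantShortTimeHLGeneralGibbs
import Summits.AtomisticToContinuum.HydrodynamicLimit.Theorems.RelayRaceLocalityNearConstantShortTimeHLGeneralFamilyFreeEnergy
import Literature.MathematicalPhysics.KineticTheory.HardSphereEulerProofs
import Literature.MathematicalPhysics.KineticTheory.HardSphereCanonicalTorus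
import Literature.MathematicalPhysics.KineticTheory.MicroscaleWindowFunctionals

/-!
# RelayRaceLocality · ConeLocalisation — stub `stub_statics : FugacityStatics` of line `Sketch`

Support file (`--supports stmt-AtomisticToContinuum-12504`) for the crux item `ConeLocalisation` (route
RelayRaceLocality of `AtomisticToContinuum/HydrodynamicLimit`), line `zoomed-bubble-transplant` (skeleton
`Cruxes/ConeLocalisation/Lines/Sketch.lean`, v2), proving the registered stub

  `stub_statics : FugacityStatics`

(`Theorems/RelayRaceLocalityConeLocalisationLocalDefs.lean`): the low-density canonical STATICS behind the
comparison gas of the glue. For continuous positive profiles `(a₀, θ₀, u₀)`: the bound `Λ⁻¹ ≤ a₀ ≤ Λ` on the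
compact torus, and for every diameter-ratio bound `K ≥ 1` a threshold `σS = σS(a₀, K)` such that

1. (identification) continuous time-`0` LLN limits `(ρ₁, u₁, θ₁)` of the conjunct's local Gibbs laws of
   `(a₀, u₀, θ₀)` at `σ < σS` are `u₁ = u₀`, `θ₁ = θ₀`, `ρ₁ = ρa` — the inverted activity
   (`NearConstantShortTimeHL.activity_inversion_continuous` at the analytic low-density equation of state
   `hsEosLowDensity_proof`: band `[(2Λ²)⁻¹, 2Λ²]`, unit mass, `a₀ = e^{c}ρa e^{g_σ(ρa)}`, i.e.
   `a₀σ³ = e^{c}Ψ(ρaσ³)` with `Ψ = hsActivity`), because the same laws satisfy the LLN towards `(ρa, u₀, θ₀)`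
   (`statics_lln_zero_matched`: the constant drops out of the canonical law, exponential concentration under the
   matched laws `NearConstantShortTimeHL.stub_concentrationGeneralFamilies`, `n_N → ∞`, `Φ₀ = id` a.s.) and limits
   in probability of the three fields identify continuous profiles (`NearConstantShortTimeHL.profiles_eq_of_tendsto`);
2. (matched activity) `bσ₂³ = e^{c₂}Ψ(ρ₂σ₂³)` with `ρ₂ ∈ [½, 2]` continuous of unit mass and `σ₂³ ≤ Kσ³` means
   `b = e^{c₂} ρ₂ e^{g_{σ₂}(ρ₂)}` (continuous and positive: `Ψ` is continuous at small packing,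
   `statics_exists_continuousOn_hsActivity`), so along the commensurate family
   `(hsDiameter σ N, ⌈(σ₂/σ)³(N+1)⌉₊)` (admissible: `statics_tendsto_ceil_mul_hsDiameter`) the canonical laws of
   `(b, u₂, θ₂)` satisfy the time-`0` LLN towards `(ρ₂, u₂, θ₂)` (`statics_lln_zero_matched` at reduced diameter
   `σ₂`) and are probability measures for every `N` (`statics_isProbabilityMeasure_commensurate`: the spheres fit,
   `σ³⌈(σ₂/σ)³(N+1)⌉₊ ≤ (Kσ³ + σ³)(N+1) ≤ (N+1)/8` for `σ ≤ 1/(4K)`, so `posPartition > 0` by `posPartition_pos` at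
   reduced diameter `1/2` and `posPartition_antitone_diam`).

References: E. Pulvirenti – D. Tsagkarogiannis, Comm. Math. Phys. 316 (2012) Thm 2.1 (canonical cluster expansion,
activity inversion); H. Spohn, *Large Scale Dynamics of Interacting Particles* (1991), Part I §2.3.
-/

noncomputable section

namespace Summit.AtomisticToContinuum.HydrodynamicLimit.Theorems.ConeLocalisation

open scoped Topology ENNReal
open Filter Set MeasureTheory
open Literature.MathematicalPhysics.KineticTheory Literature.Analysis.FluidPDE
  Literature.Analysis.FunctionSpaces

/-! ## The commensurate family is admissible -/

/-- The commensurate particle number `⌈(σ₂/σ)³(N+1)⌉₊` satisfies the admissibility condition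
`n · hsDiameter σ N ^ 3 → σ₂³` (squeeze between `q σ³` and `q σ³ + σ³/(N+1)`, `q = (σ₂/σ)³`). [folklore] -/
theorem statics_tendsto_ceil_mul_hsDiameter {σ σ₂ : ℝ} (hσ : 0 < σ) (hσ₂ : 0 ≤ σ₂) {n₂ : ℕ → ℕ}
    (hn : ∀ N, n₂ N = ⌈(σ₂ / σ) ^ 3 * ((N + 1 : ℕ) : ℝ)⌉₊) :
    Tendsto (fun N => (n₂ N : ℝ) * hsDiameter σ N ^ 3) atTop (𝓝 (σ₂ ^ 3)) := by
  -- adapted from `Cruxes/LightConeInLaw/Lines/susceptibility_variance_continuity.lean`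
  set q : ℝ := (σ₂ / σ) ^ 3 with hqdef
  have hq : 0 ≤ q := by positivity
  have hσ3 : σ ^ 3 ≠ 0 := by positivity
  have hqσ : q * σ ^ 3 = σ₂ ^ 3 := by rw [hqdef, div_pow, div_mul_cancel₀ _ hσ3]
  have hlow : ∀ N, q * σ ^ 3 ≤ (n₂ N : ℝ) * hsDiameter σ N ^ 3 := by
    intro N
    have hN : (0 : ℝ) < ((N + 1 : ℕ) : ℝ) := by positivity
    rw [hn N, hsDiameter_pow_three]
    calc q * σ ^ 3 = (q * ((N + 1 : ℕ) : ℝ)) * (σ ^ 3 / ((N + 1 : ℕ) : ℝ)) := by field_simp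
      _ ≤ (⌈q * ((N + 1 : ℕ) : ℝ)⌉₊ : ℝ) * (σ ^ 3 / ((N + 1 : ℕ) : ℝ)) := by
          gcongr
          exact Nat.le_ceil _
  have hup : ∀ N, (n₂ N : ℝ) * hsDiameter σ N ^ 3 ≤ q * σ ^ 3 + σ ^ 3 / ((N + 1 : ℕ) : ℝ) := by
    intro N
    have hN : (0 : ℝ) < ((N + 1 : ℕ) : ℝ) := by positivity
    rw [hn N, hsDiameter_pow_three]
    have h2 : (⌈q * ((N + 1 : ℕ) : ℝ)⌉₊ : ℝ) < q * ((N + 1 : ℕ) : ℝ) + 1 :=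
      Nat.ceil_lt_add_one (by positivity)
    calc (⌈q * ((N + 1 : ℕ) : ℝ)⌉₊ : ℝ) * (σ ^ 3 / ((N + 1 : ℕ) : ℝ))
        ≤ (q * ((N + 1 : ℕ) : ℝ) + 1) * (σ ^ 3 / ((N + 1 : ℕ) : ℝ)) := by gcongr
      _ = q * σ ^ 3 + σ ^ 3 / ((N + 1 : ℕ) : ℝ) := by field_simp
  have hlim : Tendsto (fun N : ℕ => q * σ ^ 3 + σ ^ 3 / ((N + 1 : ℕ) : ℝ)) atTop (𝓝 (q * σ ^ 3)) := by
    have h0 : Tendsto (fun N : ℕ => σ ^ 3 / ((N + 1 : ℕ) : ℝ)) atTop (𝓝 0) :=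
      (tendsto_const_div_atTop_nhds_zero_nat (σ ^ 3)).comp (tendsto_add_atTop_nat 1)
    simpa using tendsto_const_nhds.add h0
  rw [← hqσ]
  exact tendsto_of_tendsto_of_tendsto_of_le_of_le tendsto_const_nhds hlim hlow hup

/-! ## The commensurate canonical laws are probability measures -/

/-- **The commensurate canonical laws are probability measures, for every `N`** (`σ ≤ 1/4`, `σ₂³ ≤ Kσ³`,
`Kσ ≤ 1/4`, continuous positive profiles): the `n = ⌈(σ₂/σ)³(N+1)⌉₊ = k + 1` spheres of diameter
`hsDiameter σ N` fit, `hsDiameter σ N ≤ hsDiameter (1/2) k` because `σ³(k+1) ≤ (Kσ³ + σ³)(N+1) ≤ (N+1)/8`, so the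
configurational partition function is positive (`posPartition_pos` at reduced diameter `1/2`,
`posPartition_antitone_diam`) and `isProbabilityMeasure_canonicalLaw` applies. [folklore] -/
theorem statics_isProbabilityMeasure_commensurate {a θ : T3 → ℝ} {u : T3 → V3} (ha : Continuous a)
    (hθ : Continuous θ) (hu : Continuous u) (ha0 : ∀ x, 0 < a x) (hθ0 : ∀ x, 0 < θ x) {σ σ₂ K : ℝ}
    (hσ : 0 < σ) (hσ4 : σ ≤ 1 / 4) (hσ₂ : 0 < σ₂) (hK : σ₂ ^ 3 ≤ K * σ ^ 3) (hK4 : K * σ ≤ 1 / 4) (N : ℕ)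
    {n : ℕ} (hn : n = ⌈(σ₂ / σ) ^ 3 * ((N + 1 : ℕ) : ℝ)⌉₊)
    (Ψ : HardSphereFlow (Torus.geometry (Fin 3)) (hsDiameter σ N) n) :
    IsProbabilityMeasure (particleLaw Ψ (canonicalDensity (Torus.geometry (Fin 3)) (hsDiameter σ N) n
      (localGibbsProfile a u θ))) := by
  -- adapted from `Cruxes/LightConeInLaw/Lines/susceptibility_variance_continuity.lean`
  obtain ⟨A, -, hA⟩ := exists_forall_abs_le_of_continuous ha
  have hA' : ∀ x, a x ≤ A := fun x => (le_abs_self _).trans (hA x)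
  have ha0' : ∀ x, 0 ≤ a x := fun x => (ha0 x).le
  have hq0 : 0 < (σ₂ / σ) ^ 3 * ((N + 1 : ℕ) : ℝ) := by positivity
  have hn1 : 1 ≤ n := by rw [hn]; exact Nat.one_le_ceil_iff.2 hq0
  obtain ⟨k, hk⟩ : ∃ k, n = k + 1 := ⟨n - 1, (Nat.sub_add_cancel hn1).symm⟩
  have hkq : ((k + 1 : ℕ) : ℝ) < (σ₂ / σ) ^ 3 * ((N + 1 : ℕ) : ℝ) + 1 := by
    rw [← hk, hn]; exact Nat.ceil_lt_add_one hq0.le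
  have hdiam : hsDiameter σ N ≤ hsDiameter (1 / 2) k := by
    refine le_of_pow_le_pow_left₀ (by norm_num : (3 : ℕ) ≠ 0) (hsDiameter_pos (by norm_num) k).le ?_
    rw [hsDiameter_pow_three, hsDiameter_pow_three]
    have hN : (0 : ℝ) < ((N + 1 : ℕ) : ℝ) := by positivity
    have hk0 : (0 : ℝ) < ((k + 1 : ℕ) : ℝ) := by positivity
    rw [div_le_div_iff₀ hN hk0]
    have hc3 : σ ^ 3 * ((σ₂ / σ) ^ 3 * ((N + 1 : ℕ) : ℝ)) = σ₂ ^ 3 * ((N + 1 : ℕ) : ℝ) := by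
      rw [div_pow]; field_simp
    have h1N : (1 : ℝ) ≤ ((N + 1 : ℕ) : ℝ) := by exact_mod_cast Nat.succ_le_succ (Nat.zero_le N)
    have hN0 : (0 : ℝ) ≤ ((N + 1 : ℕ) : ℝ) := hN.le
    have hσsq : σ ^ 2 ≤ (1 / 4) ^ 2 := pow_le_pow_left₀ hσ.le hσ4 2
    have hKσ3 : K * σ ^ 3 ≤ 1 / 64 := by
      calc K * σ ^ 3 = K * σ * σ ^ 2 := by ring
        _ ≤ (1 / 4) * (1 / 4) ^ 2 := mul_le_mul hK4 hσsq (by positivity) (by norm_num)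
        _ = 1 / 64 := by norm_num
    have hσ3 : σ ^ 3 ≤ 1 / 64 := by
      calc σ ^ 3 ≤ (1 / 4) ^ 3 := pow_le_pow_left₀ hσ.le hσ4 3
        _ = 1 / 64 := by norm_num
    calc σ ^ 3 * ((k + 1 : ℕ) : ℝ) ≤ σ ^ 3 * ((σ₂ / σ) ^ 3 * ((N + 1 : ℕ) : ℝ) + 1) :=
          mul_le_mul_of_nonneg_left hkq.le (by positivity)
      _ = σ₂ ^ 3 * ((N + 1 : ℕ) : ℝ) + σ ^ 3 := by rw [mul_add, hc3, mul_one]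
      _ ≤ K * σ ^ 3 * ((N + 1 : ℕ) : ℝ) + σ ^ 3 := by gcongr
      _ ≤ 1 / 64 * ((N + 1 : ℕ) : ℝ) + 1 / 64 * ((N + 1 : ℕ) : ℝ) := by
          refine add_le_add (mul_le_mul_of_nonneg_right hKσ3 hN0) ?_
          calc σ ^ 3 ≤ 1 / 64 := hσ3
            _ = 1 / 64 * 1 := (mul_one _).symm
            _ ≤ 1 / 64 * ((N + 1 : ℕ) : ℝ) := mul_le_mul_of_nonneg_left h1N (by positivity)
      _ ≤ (1 / 2) ^ 3 * ((N + 1 : ℕ) : ℝ) := by nlinarith [hN0]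
  have hZ : 0 < posPartition a (hsDiameter σ N) n := by
    rw [hk]
    exact (posPartition_pos ha ha0 (le_refl (1 / 2 : ℝ)) k).trans_le
      (NearConstantShortTimeHL.posPartition_antitone_diam ha.measurable ha0' hA' hdiam (k + 1))
  rw [particleLaw_eq, NearConstantShortTimeHL.liouville_withDensity_canonicalDensity]
  exact NearConstantShortTimeHL.isProbabilityMeasure_canonicalLaw ha.measurable hθ.measurable hu.measurable
    ha0' hA' hθ0 hZ

/-! ## The activity map is continuous at small packing -/

/-- **`Ψ = hsActivity` is continuous on `(0, ηc)`** for some `ηc > 0`: there the excess free energy is the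
analytic `F` of the low-density equation of state (`hsEosLowDensity_proof`), locally, so `f_ex = F` and
`f_ex′ = F′` pointwise and `Ψ(η) = η exp(F(η) + ηF′(η))`. [folklore] -/
theorem statics_exists_continuousOn_hsActivity : ∃ ηc : ℝ, 0 < ηc ∧ ContinuousOn hsActivity (Ioo 0 ηc) := by
  obtain ⟨η₀, hη₀, F, hF, hEq, -, -, -⟩ := hsEosLowDensity_proof
  refine ⟨η₀, hη₀, ?_⟩
  have hsub : Ioo 0 η₀ ⊆ Ioo (-η₀) η₀ := fun η hη => ⟨by linarith [hη.1], hη.2⟩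
  have hFc : ContinuousOn F (Ioo 0 η₀) := hF.continuousOn.mono hsub
  have hF'c : ContinuousOn (deriv F) (Ioo 0 η₀) := hF.deriv.continuousOn.mono hsub
  have hcont : ContinuousOn (fun η => η * Real.exp (F η + η * deriv F η)) (Ioo 0 η₀) :=
    continuousOn_id.mul ((hFc.add (continuousOn_id.mul hF'c)).rexp)
  refine hcont.congr fun η hη => ?_
  show hsActivity η = η * Real.exp (F η + η * deriv F η)
  rw [hsActivity, hEq ⟨hη.1.le, hη.2⟩, (HardSphereLDA.hsExcessFreeEnergy_eventuallyEq' hEq hη).deriv_eq]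

/-! ## Law of large numbers at flow-time `0` under canonical laws with a matched activity -/

/-- **LLN at flow-time `0` for canonical local Gibbs laws whose activity is a constant multiple of a matched
activity.** With the packing threshold `η₂` of `NearConstantShortTimeHL.stub_concentrationGeneralFamilies`: for a
reduced diameter `τ > 0`, a continuous unit-mass density `ρ` in the band `c₀ ≤ ρ`, `ρτ³ ≤ η₂`, continuous `u`,
`θ > 0`, an activity `a = C₀ · ρ e^{g_τ(ρ)}` (`C₀ ≠ 0`) and an admissible family `(ε_N → 0, n_N ε_N³ → τ³)`, the
three empirical fields at flow-time `0` satisfy, under the canonical laws of `(a, u, θ)` through any flows, the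
law of large numbers towards `(ρ, u, θ)`: the constant drops out of the canonical law
(`KineticWindowGronwallNegative.canonicalDensity_const_mul`), so the laws ARE the matched laws; exponential
concentration (`stub_concentrationGeneralFamilies`), `n_N → ∞` (`tendsto_atTop_of_tendsto_mul_pow_three`,
`tendsto_zero_of_le_exp`), and `Φ₀ = id` almost surely (`measure_setOf_flow_zero_mem`).
[cite: PulvirentiTsagkarogiannis2012, Thm 2.1] -/
theorem statics_lln_zero_matched : ∃ η₂ : ℝ, 0 < η₂ ∧ ∀ τ : ℝ, 0 < τ → ∀ c₀ : ℝ, 0 < c₀ →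
    ∀ (ρ θ a : T3 → ℝ) (u : T3 → V3), Continuous ρ → (∀ x, c₀ ≤ ρ x ∧ ρ x * τ ^ 3 ≤ η₂) →
    (∫ x, ρ x) = 1 → Continuous u → Continuous θ → (∀ x, 0 < θ x) → ∀ C₀ : ℝ, C₀ ≠ 0 →
    (∀ x, a x = C₀ * (ρ x * Real.exp (hsExcessFreeEnergy (ρ x * τ ^ 3) +
      ρ x * τ ^ 3 * deriv hsExcessFreeEnergy (ρ x * τ ^ 3)))) →
    ∀ (ε : ℕ → ℝ) (n : ℕ → ℕ), (∀ N, 0 < ε N) → Tendsto ε atTop (𝓝 0) →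
    Tendsto (fun N => (n N : ℝ) * ε N ^ 3) atTop (𝓝 (τ ^ 3)) →
    ∀ Φ : (N : ℕ) → HardSphereFlow (Torus.geometry (Fin 3)) (ε N) (n N),
    ∀ χ : T3 → ℝ, Continuous χ → ∀ δ : ℝ, 0 < δ →
      Tendsto (fun N => particleLaw (Φ N) (canonicalDensity (Torus.geometry (Fin 3)) (ε N) (n N)
        (localGibbsProfile a u θ)) {z | δ < |empiricalDensityField ((Φ N).flow 0 z) χ - ∫ x, χ x * ρ x|})
        atTop (𝓝 0) ∧
      Tendsto (fun N => particleLaw (Φ N) (canonicalDensity (Torus.geometry (Fin 3)) (ε N) (n N)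
        (localGibbsProfile a u θ)) {z | δ < ‖empiricalMomentumField ((Φ N).flow 0 z) χ -
          ∫ x, (χ x * ρ x) • u x‖}) atTop (𝓝 0) ∧
      Tendsto (fun N => particleLaw (Φ N) (canonicalDensity (Torus.geometry (Fin 3)) (ε N) (n N)
        (localGibbsProfile a u θ)) {z | δ < |empiricalEnergyField ((Φ N).flow 0 z) χ -
          ∫ x, χ x * totalEnergyDensity (ρ x) (u x) (θ x)|}) atTop (𝓝 0) := by
  -- adapted from `NearConstantShortTimeHL.staticLLN_explicit` (Step 2)
  obtain ⟨η₂, hη₂, H2⟩ := NearConstantShortTimeHL.stub_concentrationGeneralFamilies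
  refine ⟨η₂, hη₂, ?_⟩
  intro τ hτ c₀ hc₀ ρ θ a u hρ hband hmass hu hθ hθ0 C₀ hC₀ ha ε n hε hε0 hn Φ χ hχ δ hδ
  have hn_top : Tendsto n atTop atTop :=
    NearConstantShortTimeHL.tendsto_atTop_of_tendsto_mul_pow_three hτ hε hε0 hn
  set g : ℝ → ℝ := fun r => hsExcessFreeEnergy (r * τ ^ 3) + r * τ ^ 3 * deriv hsExcessFreeEnergy (r * τ ^ 3)
    with hgdef
  -- the constant drops out: the laws ARE the matched laws of `(ρ, u, θ)`
  have haeq : a = fun x => C₀ * (ρ x * Real.exp (g (ρ x))) := funext ha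
  have hcd : ∀ N, canonicalDensity (Torus.geometry (Fin 3)) (ε N) (n N) (localGibbsProfile a u θ) =
      canonicalDensity (Torus.geometry (Fin 3)) (ε N) (n N)
        (localGibbsProfile (fun x => ρ x * Real.exp (g (ρ x))) u θ) := by
    intro N
    funext z
    rw [haeq, MacroClosureLine.StubLedger.localGibbsProfile_const_mul]
    exact KineticWindowGronwallNegative.canonicalDensity_const_mul hC₀ _ _ z
  have hPeq : ∀ N, particleLaw (Φ N) (canonicalDensity (Torus.geometry (Fin 3)) (ε N) (n N)
      (localGibbsProfile a u θ)) =
      particleLaw (Φ N) (canonicalDensity (Torus.geometry (Fin 3)) (ε N) (n N)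
        (localGibbsProfile (fun x => ρ x * Real.exp (g (ρ x))) u θ)) := fun N => by rw [hcd N]
  have hac : ∀ N, particleLaw (Φ N) (canonicalDensity (Torus.geometry (Fin 3)) (ε N) (n N)
      (localGibbsProfile a u θ)) ≪ liouville (Torus.geometry (Fin 3)) (n N) (ε N) :=
    fun N => withDensity_absolutelyContinuous _ _
  -- exponential concentration under the matched laws, moved to flow-time `0`
  have hS := H2 τ hτ c₀ hc₀ ρ hρ hband hmass u θ hu hθ hθ0 ε n hε hε0 hn
  obtain ⟨C, hC, hCN⟩ := hS χ hχ δ hδ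
  refine ⟨NearConstantShortTimeHL.tendsto_zero_of_le_exp hn_top hC fun N => ?_,
    NearConstantShortTimeHL.tendsto_zero_of_le_exp hn_top hC fun N => ?_,
    NearConstantShortTimeHL.tendsto_zero_of_le_exp hn_top hC fun N => ?_⟩
  · refine (NearConstantShortTimeHL.measure_setOf_flow_zero_mem (Φ N) (hac N)
      {z | δ < |empiricalDensityField z χ - ∫ x, χ x * ρ x|}).le.trans ?_
    rw [hPeq N]
    exact (hCN N).1
  · refine (NearConstantShortTimeHL.measure_setOf_flow_zero_mem (Φ N) (hac N)
      {z | δ < ‖empiricalMomentumField z χ - ∫ x, (χ x * ρ x) • u x‖}).le.trans ?_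
    rw [hPeq N]
    exact (hCN N).2.1
  · refine (NearConstantShortTimeHL.measure_setOf_flow_zero_mem (Φ N) (hac N)
      {z | δ < |empiricalEnergyField z χ - ∫ x, χ x * totalEnergyDensity (ρ x) (u x) (θ x)|}).le.trans ?_
    rw [hPeq N]
    exact (hCN N).2.2

/-! ## The stub -/

/-- **Stub `stub_statics` of line `Sketch` — `FugacityStatics`, the low-density canonical statics behind the
comparison gas.** `Λ` bounds the continuous positive activity on the compact torus; `σS(a₀, K)` is the minimum of
the lattice-packing threshold `1/(4K)`, the inversion threshold `η_A/Λ²`, the concentration bands `η₂/(2Λ²)`,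
`η₂/(2K)`, and the continuity band `ηc/(4K)` of `Ψ`. (1) Inversion `a₀ = e^{c}ρa e^{g_σ(ρa)}`
(`activity_inversion_continuous`), LLN of the crux's (probability) laws towards `(ρa, u₀, θ₀)`
(`statics_lln_zero_matched` along the conjunct family) and uniqueness of limits in probability
(`profiles_eq_of_tendsto`) identify the tied data; `a₀σ³ = e^{c}Ψ(ρ₁σ³)` is the inversion identity.
(2) A matched activity `bσ₂³ = e^{c₂}Ψ(ρ₂σ₂³)` is `b = e^{c₂}ρ₂e^{g_{σ₂}(ρ₂)}`, continuous and positive, so its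
canonical laws along the commensurate family are probability measures (`statics_isProbabilityMeasure_commensurate`)
with the time-`0` LLN towards `(ρ₂, u₂, θ₂)` (`statics_lln_zero_matched` at reduced diameter `σ₂`,
`statics_tendsto_ceil_mul_hsDiameter`). [cite: PulvirentiTsagkarogiannis2012, Thm 2.1] -/
theorem stub_statics : FugacityStatics := by
  obtain ⟨η₂, hη₂, HL⟩ := statics_lln_zero_matched
  obtain ⟨ηE, hηE, F, hFa, hEqF, hF0, -, -⟩ := hsEosLowDensity_proof
  obtain ⟨ηA, hηA, hinvA⟩ := NearConstantShortTimeHL.activity_inversion_continuous hηE hFa hEqF hF0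
  obtain ⟨ηc, hηc, hΨc⟩ := statics_exists_continuousOn_hsActivity
  intro a₀ θ₀ u₀ ha hθ hu ha0 hθ0
  -- bounds on the activity profile (as in `NearConstantShortTimeHL.staticLLN_explicit`)
  obtain ⟨Aup, -, hAup⟩ := exists_forall_abs_le_of_continuous ha
  obtain ⟨x₀, -, hx₀⟩ := isCompact_univ.exists_isMinOn univ_nonempty ha.continuousOn
  have hamin : ∀ x, a₀ x₀ ≤ a₀ x := fun x => hx₀ (mem_univ x)
  set Λ : ℝ := max (max Aup (a₀ x₀)⁻¹) 1 with hΛdef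
  have hΛ1 : 1 ≤ Λ := le_max_right _ _
  have hΛ0 : 0 < Λ := one_pos.trans_le hΛ1
  have haΛ : ∀ x, Λ⁻¹ ≤ a₀ x ∧ a₀ x ≤ Λ := by
    intro x
    constructor
    · have h1 : (a₀ x₀)⁻¹ ≤ Λ := (le_max_right _ _).trans (le_max_left _ _)
      calc Λ⁻¹ ≤ ((a₀ x₀)⁻¹)⁻¹ := inv_anti₀ (inv_pos.2 (ha0 x₀)) h1
        _ = a₀ x₀ := inv_inv _
        _ ≤ a₀ x := hamin x
    · exact ((le_abs_self _).trans (hAup x)).trans ((le_max_left _ _).trans (le_max_left _ _))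
  refine ⟨Λ, hΛ1, haΛ, fun K hK => ?_⟩
  have hK0 : 0 < K := one_pos.trans_le hK
  have hΛ2 : 0 < Λ ^ 2 := pow_pos hΛ0 2
  -- the threshold in `σ`
  set σS : ℝ := min (1 / (4 * K)) (min (ηA / Λ ^ 2) (min (η₂ / (2 * Λ ^ 2)) (min (η₂ / (2 * K))
    (ηc / (4 * K))))) with hσSdef
  have hσS : 0 < σS :=
    lt_min (by positivity) (lt_min (by positivity) (lt_min (by positivity) (lt_min (by positivity)
      (by positivity))))
  -- consequences of `σ < σS`
  have hthr : ∀ σ : ℝ, 0 < σ → σ < σS → σ ≤ 1 / 4 ∧ K * σ ≤ 1 / 4 ∧ σ ^ 3 ≤ σ ∧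
      Λ ^ 2 * σ ^ 3 ≤ ηA ∧ 2 * Λ ^ 2 * σ ^ 3 ≤ η₂ ∧ 2 * K * σ ^ 3 ≤ η₂ ∧ 4 * K * σ ^ 3 ≤ ηc := by
    intro σ hσ hσS'
    have h4K : σ ≤ 1 / (4 * K) := (hσS'.trans_le (min_le_left _ _)).le
    have hKσ : K * σ ≤ 1 / 4 := by
      rw [le_div_iff₀ (by positivity)] at h4K
      linarith
    have hσ4 : σ ≤ 1 / 4 := by nlinarith
    have hσ1 : σ ≤ 1 := by linarith
    have hσ3le : σ ^ 3 ≤ σ := by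
      calc σ ^ 3 = σ * (σ * σ) := by ring
        _ ≤ σ * 1 := mul_le_mul_of_nonneg_left (mul_le_one₀ hσ1 hσ.le hσ1) hσ.le
        _ = σ := mul_one σ
    have hle : ∀ {A B : ℝ}, 0 < A → σ ≤ B / A → A * σ ^ 3 ≤ B := by
      intro A B hA h
      rw [le_div_iff₀ hA] at h
      calc A * σ ^ 3 ≤ A * σ := mul_le_mul_of_nonneg_left hσ3le hA.le
        _ = σ * A := mul_comm _ _
        _ ≤ B := h
    refine ⟨hσ4, hKσ, hσ3le, hle hΛ2 ?_, hle (by positivity) ?_, hle (by positivity) ?_,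
      hle (by positivity) ?_⟩
    · exact (hσS'.trans_le ((min_le_right _ _).trans (min_le_left _ _))).le
    · exact (hσS'.trans_le ((min_le_right _ _).trans ((min_le_right _ _).trans (min_le_left _ _)))).le
    · exact (hσS'.trans_le ((min_le_right _ _).trans ((min_le_right _ _).trans ((min_le_right _ _).trans
        (min_le_left _ _))))).le
    · exact (hσS'.trans_le ((min_le_right _ _).trans ((min_le_right _ _).trans ((min_le_right _ _).trans
        (min_le_right _ _))))).le
  refine ⟨σS, hσS, ?_, ?_⟩
  · ------------------------------------------------------------------
    -- (1) identification of the tied data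
    ------------------------------------------------------------------
    intro σ hσ hσS' ρ₁ θ₁ u₁ hρ₁ hθ₁ hu₁ Φ₁ hL1
    obtain ⟨hσ4, -, -, hpack, hband2, -, -⟩ := hthr σ hσ hσS'
    have hσ3 : 0 < σ ^ 3 := pow_pos hσ 3
    have hσhalf : σ ≤ 1 / 2 := hσ4.trans (by norm_num)
    -- inversion of the activity
    obtain ⟨ρst, hρstc, hρstb, hρst1, c, hc⟩ := hinvA σ hσ Λ hΛ1 hpack a₀ ha haΛ
    have hρst0 : ∀ x, 0 < ρst x := fun x => (by positivity : (0 : ℝ) < (2 * Λ ^ 2)⁻¹).trans_le (hρstb x).1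
    -- the crux's laws are probability measures with the LLN towards `(ρst, u₀, θ₀)` at flow-time `0`
    have hP : ∀ N, IsProbabilityMeasure (localGibbsLaw σ a₀ u₀ θ₀ N (Φ₁ N)) := fun N =>
      isProbabilityMeasure_localGibbsLaw ha hθ hu ha0 hθ0 hσhalf N (Φ₁ N)
    have hnε : Tendsto (fun N => ((N + 1 : ℕ) : ℝ) * hsDiameter σ N ^ 3) atTop (𝓝 (σ ^ 3)) := by
      rw [show (fun N => ((N + 1 : ℕ) : ℝ) * hsDiameter σ N ^ 3) = fun _ => σ ^ 3 from
        funext fun N => succ_mul_hsDiameter_pow_three σ N]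
      exact tendsto_const_nhds
    have h2 := HL σ hσ (2 * Λ ^ 2)⁻¹ (by positivity) ρst θ₀ a₀ u₀ hρstc
      (fun x => ⟨(hρstb x).1, (mul_le_mul_of_nonneg_right (hρstb x).2 hσ3.le).trans hband2⟩) hρst1 hu hθ
      hθ0 (Real.exp c) (Real.exp_pos c).ne' (fun x => by rw [hc x]; ring) (fun N => hsDiameter σ N)
      (fun N => N + 1) (fun N => hsDiameter_pos hσ N) (tendsto_hsDiameter σ) hnε Φ₁
    -- identification of the two continuous limit triples
    obtain ⟨hρeq, hueq, hθeq⟩ := NearConstantShortTimeHL.profiles_eq_of_tendsto hP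
      (fun N z χ => empiricalDensityField ((Φ₁ N).flow 0 z) χ)
      (fun N z χ => empiricalMomentumField ((Φ₁ N).flow 0 z) χ)
      (fun N z χ => empiricalEnergyField ((Φ₁ N).flow 0 z) χ)
      hρstc hθ hu hρ₁ hθ₁ hu₁ hρst0 h2 (fun χ hχ δ hδ => hL1 χ hχ δ hδ)
    refine ⟨hueq.symm, hθeq.symm, ?_, ?_, c, fun x => ?_⟩
    · rw [← hρeq]; exact hρstb
    · rw [← hρeq]; exact hρst1
    · rw [← hρeq, hsActivity, hc x]; ring
  · ------------------------------------------------------------------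
    -- (2) matched activity: probability and LLN along the commensurate family
    ------------------------------------------------------------------
    intro σ hσ hσS' σ₂ hσ₂ hσ₂K b θ₂ ρ₂ u₂ hθ₂ hu₂ hρ₂ hθ₂0 hρ₂b hρ₂1 c₂ hb n₂ Φ₂
    dsimp only
    obtain ⟨hσ4, hKσ, -, -, -, h2K, hcK⟩ := hthr σ hσ hσS'
    have hσ₂3 : 0 < σ₂ ^ 3 := pow_pos hσ₂ 3
    have hρ₂0 : ∀ x, 0 < ρ₂ x := fun x => (by norm_num : (0 : ℝ) < 2⁻¹).trans_le (hρ₂b x).1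
    -- the band of gas 2 at reduced diameter `σ₂`
    have hησ₂ : ∀ x, ρ₂ x * σ₂ ^ 3 ≤ 2 * K * σ ^ 3 := fun x =>
      calc ρ₂ x * σ₂ ^ 3 ≤ 2 * (K * σ ^ 3) := mul_le_mul (hρ₂b x).2 hσ₂K hσ₂3.le (by norm_num)
        _ = 2 * K * σ ^ 3 := by ring
    have hband₂ : ∀ x, 2⁻¹ ≤ ρ₂ x ∧ ρ₂ x * σ₂ ^ 3 ≤ η₂ := fun x => ⟨(hρ₂b x).1, (hησ₂ x).trans h2K⟩
    have hmem : ∀ x, ρ₂ x * σ₂ ^ 3 ∈ Ioo 0 ηc := fun x =>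
      ⟨mul_pos (hρ₂0 x) hσ₂3, (hησ₂ x).trans_lt (by nlinarith [pow_pos hσ 3])⟩
    -- the matched form of `b`
    have hbΨ : ∀ x, b x = Real.exp c₂ * hsActivity (ρ₂ x * σ₂ ^ 3) / σ₂ ^ 3 := fun x => by
      rw [← hb x, mul_div_cancel_right₀ _ hσ₂3.ne']
    have hbx : ∀ x, b x = Real.exp c₂ * (ρ₂ x * Real.exp (hsExcessFreeEnergy (ρ₂ x * σ₂ ^ 3) +
        ρ₂ x * σ₂ ^ 3 * deriv hsExcessFreeEnergy (ρ₂ x * σ₂ ^ 3))) := fun x => by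
      rw [hbΨ x, hsActivity]
      field_simp
    have hb0 : ∀ x, 0 < b x := fun x => by
      rw [hbx x]; exact mul_pos (Real.exp_pos _) (mul_pos (hρ₂0 x) (Real.exp_pos _))
    have hbc : Continuous b := by
      rw [show b = fun x => Real.exp c₂ * hsActivity (ρ₂ x * σ₂ ^ 3) / σ₂ ^ 3 from funext hbΨ]
      exact (continuous_const.mul (hΨc.comp_continuous (hρ₂.mul continuous_const) hmem)).div_const _
    refine ⟨fun N => statics_isProbabilityMeasure_commensurate hbc hθ₂ hu₂ hb0 hθ₂0 hσ hσ4 hσ₂ hσ₂K hKσ N rfl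
      (Φ₂ N), ?_⟩
    have hn₂t : Tendsto (fun N => (n₂ N : ℝ) * hsDiameter σ N ^ 3) atTop (𝓝 (σ₂ ^ 3)) :=
      statics_tendsto_ceil_mul_hsDiameter hσ hσ₂.le fun N => rfl
    exact HL σ₂ hσ₂ 2⁻¹ (by norm_num) ρ₂ θ₂ b u₂ hρ₂ hband₂ hρ₂1 hu₂ hθ₂ hθ₂0 (Real.exp c₂)
      (Real.exp_pos c₂).ne' hbx (fun N => hsDiameter σ N) n₂ (fun N => hsDiameter_pos hσ N)
      (tendsto_hsDiameter σ) hn₂t Φ₂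

end Summit.AtomisticToContinuum.HydrodynamicLimit.Theorems.ConeLocalisation

end
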